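import Literature.Claims.NS.ClayVariants
import Literature.Analysis.FluidPDE.ClassicalSolution
import Literature.Analysis.FluidPDE.NSLerayHopf
import Mathlib.Analysis.Calculus.FDeriv.Analytic
import Mathlib.Analysis.Calculus.IteratedDeriv.Defs
import Literature.Analysis.Calculus.AnalyticOfFDerivBound
import Literature.Analysis.Calculus.AnalyticCauchyEstimates
import HarnessLib

/-!
# Claim skeleton: Strange (2025), «Analytic Solution of the N-Dimensional Incompressible
# Navier-Stokes Equations» (arXiv:2501.08353 v3)

Cell `ns-claims` (D-0090 NS-CLAIMS SWEEP), claim C48, typist `ns-claims-typist-9` (g2).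
UNREFEREED/DISPUTED CLAIM under adjudication — NOTHING in this file asserts a step: every `Step…`
declaration is a `Prop` (one printed assertion or asserted implication, typed concretely so that its
negation or its vacuity can be a kernel theorem in
`Summits/NavierStokesRegularity/NavierStokesRegularity/Theorems/SoloRefuteStrange2025.lean`); the
`theorem`s are unfolding lemmas, the kernel COMPOSITION of the paper's own implications, and the Clay
link. The author's arXiv comment (v3) reads «This is still a draft, and I am considering restructuring
the paper to de-emphasize the Clay Math result».

Version of record: N. Strange, arXiv:2501.08353 **v3** [physics.flu-dyn], 27 Feb 2025 (TeX 12 KB; no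
journal version; 14 pp., PDF page = printed page). Texts: the corpus copy `paper:arxiv-2501.08353`
(TeX-derived) and the v3 PDF page texts `pub/ns-claims/sources/Strange2025/arXiv-2501.08353v3-PDF/
pages-v3/p001–p014.txt` (ns-claims-lit-1 g5; LOCATORS head note): displayed equations are cited by their
PRINTED numbers with the TeX label in brackets, e.g. (4.3) [`velcond1b`]. Bib key `Strange2025`
(lean/references.bib, commit 64b7fe021d41).

EVIDENT MISPRINTS, typed as intended (REF practice F1): (i) the viscous term of (1.1) [`navstokes_momentum`]
and of (3.8) [`momentum_sol`] is printed `ν Σₖ ∂²/∂xₖ² uₖ` (for `ν Δu_j`); the paper cites the equation as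
Fefferman's (1), which is typed (`IsClassicalNSSolutionOn`); (ii) Cor. 4.1/4.2 print «there exist
smooth functions p(t,x) and f(t,x)» (for `p` and `u`); (iii) Cor. 4.1's closing «for all m if k ≥ 1»
uses a one-dimensional integral for an integral over `ℝ³`. None is load-bearing.

## Claimed statement (as printed)

Abstract (p. 1): «This paper presents an analytic solution of the incompressible Navier-Stokes equations as
recurrence relations for the solution's derivatives, addressing the Clay Mathematics Institute's
Millennium Prize problem on Navier–Stokes existence and smoothness.» §1.1, last sentence (p. 2): «In this paper
I will show that (A) is true and that (B) is true if the initial conditions for velocity and pressure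
are analytic.» **Corollary 4.1** (§4, p. 11) restates Fefferman's (A) verbatim («Take ν > 0 and N = 3.
Let u_j be any smooth, divergence free vector field satisfying (4.1) |∂^α u⁰_j(x)| ≤ C_{αk}/(1+‖x‖)^k
… Take f to be identically zero. Then there exist smooth functions … on ℝ³ × [0,∞) that satisfy (1.1),
(1.2), (1.3) and (4.2) ∫_{ℝ³} ‖u(t,x)‖² dx ≤ C, ∀ t ≥ 0»). Typed: `ClaimedTheorem :=
ClayVariants.clayR3.Regularity` — Clay (A) ITSELF (Literature files cite (A) through `ClayVariants`,
never restate it); `clay_of_claimed` is `id`. Cor. 4.2 = (B) restricted to real-analytic data: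
`ClaimedTheoremB`.

## Clay delta (reference `ClayVariants.lean`)

None at the statement: Cor. 4.1 IS (A) (Δ1–Δ8 all =). The analyticity restriction the proof needs
(«if the initial conditions … are analytic») is carried by Step 2 for (A) and is printed into the
statement only for (B) (Cor. 4.2 p. 13 ⇒ Δ4 for the periodic half, recorded as `ClaimedTheoremB`).

## Steps — the printed proof of Cor. 4.1 (§4, p. 12–13) in dependency order (HYGIENE 11; F15 twins where the
## printed inference lives below the Navier–Stokes grain)

* Step 1 = `Step1_Prop22` — Prop. 2.2 (2.17), p. 4 (§2.4, after Krantz–Parks): a `C^∞` function on an open set is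
  real-analytic iff it obeys locally uniform Cauchy bounds `‖Dⁿf(x⁰)‖ ≤ C n!/Rⁿ` — classical/true
  (support; typed with the Fréchet-derivative norm, equivalent to the printed multi-index form up to
  the constants `α! ≤ |α|! ≤ N^{|α|} α!`).
* **Step 2 = `Step2_ClayDataAnalytic`** — Cor. 4.1 proof, (4.3) [`velcond1b`], p. 12: «The initial velocity
  condition in (4.1) is consistent with Proposition 2.2: |∂^α u⁰_j(x⁰)| ≤ C_{αk}/(1+‖x⁰‖)^k ≤
  U/R^{|α|} α!. Therefore the initial condition u_j(t⁰,x) = u⁰_j(x) is analytic for any x ∈ ℝ^N.» —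
  every Clay datum (smooth, (4)) is real-analytic on `ℝ³`. FIRST LOAD-BEARING STEP; SUSPICIOUS
  (typist's prediction missed it: a smooth compactly supported divergence-free field obeys (4) and is
  not real-analytic — identity principle).
* **Step 3 = `Step3_Theorem32`** — Theorem 3.2, p. 8 (§3.3) as Cor. 4.1 USES it (p. 12: «As force is identically
  zero, by Theorem 3.2, u_j(t,x), p(t,x) ∈ C^ω(ℝ^N) ⊂ C^∞(ℝ^N)»): for `ν > 0`, `N = 3`, `f ≡ 0` and a
  real-analytic divergence-free datum there EXISTS a pair `(u, p)`, real-analytic on an open space-time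
  set containing `[0,∞) × ℝ³`, solving (1)–(3). The printed theorem is more general (any `N`, analytic
  `f`, any `X ⊆ ℝ^{N+1}`, plus the coefficient recurrence (3.8) [`momentum_sol`] — the momentum equation
  differentiated, automatic for smooth solutions and not typed). SUSPICIOUS: its printed proof is the
  inference «the right hand side of (1.1) is analytic and u(t,x) ∈ C^ω(X)» (p. 8; §1 p. 1: «The
  Cauchy–Kovalevskaya Theorem tells us …»), typed at the scalar grain it is stated in as the F15 twin
  **`Step3_inference_heat`** (analytic datum ⇒ a jointly analytic local solution of `∂ₜh = ν∂ₓ²h` —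
  Kovalevskaya's heat-equation phenomenon, barrier `Literature/Barriers/NavierStokesRegularity/
  TimeTaylorFiniteRadius.lean`: for `h₀ = 1/(1+x²)` any jointly analytic solution would have
  `∂ₜᵐh(0,0) = νᵐ h₀^{(2m)}(0) = (−ν)ᵐ(2m)!`, radius `0`). No implication between the twin and Step 3
  is claimed (the referee decides the charge, REF F1; C75 precedent `Step5_Theorem301_scalar`).
* Step 4 = `Step4_TimeSeriesEnergy` — Cor. 4.1 proof, (4.4)–(4.5) [`alt_taylor`, `ke_constaint`], p. 12: «expand u(t,x)
  as a univariate Taylor series in t alone … The integral in (ke_constaint2) can be written with this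
  series as ∫_{ℝ³}‖u(t,x)‖² dx = Σ_m (∫_{ℝ³}‖u^m(t⁰,x)‖² dx) Δ_m(t;t⁰) = T^m(t⁰) Δ_m» — for ALL
  `t ≥ 0` (the conclusion (4.2) is «∀ t ≥ 0»): the energy is the sum of its time-Taylor series at `t⁰ = 0`,
  with the Leibniz coefficients `T^m = ∫ Σ_p C(m,p) ⟪∂ₜᵖu(0,x), ∂ₜ^{m−p}u(0,x)⟫` of (3.21)/(3.22), p. 10–11
  (the display (4.5) prints `‖u^m‖²`; the paper's own (3.22) is the Leibniz form, typed). SUSPICIOUS (entire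
  time expansion; for the heat part false already for Gaussian data — barrier `not_exists_entire_timeSeries`;
  §5 of the paper itself: «the convergence of these solutions is limited by the radius of convergence»).
* Step 5 = `Step5_DerivativeDecay` — Cor. 4.1 proof, (4.6)–(4.9) [`goal`, `goal_met`], p. 12: «assume the bounds on the
  u^{0α} derivatives also hold for the u^{mα} derivatives: |u_j^m(t⁰,x)| ≤ C_k/(1+‖x‖)^k … This is
  consistent with the assumption in (4.6): (4.9) |u_j^m(t⁰,x)| ≤ … ≤ C′_{αk}/(1+‖x‖)^k» — the time
  derivatives of ALL orders at `t⁰` decay like the datum with an `m`-INDEPENDENT constant. SUSPICIOUS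
  (assumed, then declared «consistent»; `∂ₜᵐu(0,·)` carries `(νΔ)ᵐu⁰`, generically `∼ (2m)!`).
* Step 6 = `Step6_EnergyBounded` — Cor. 4.1 proof, (4.10) [`kebound`] p. 12 to «□» p. 13: «Putting this
  constraint into (4.5) yields (4.10) T^m(t⁰) ≤ N ∫_{ℝ³}(C′_k/(1+‖x‖)^k)² dx … Therefore, T^m(t⁰) ≤ C … for all m if
  k ≥ 1, and the flow's kinetic energy in (4.5) is bounded.» NS-level: representation (Step 4)
  ∧ decay (Step 5) ⇒ (7). Its two printed inferences at scalar grain (F15 twins, no implication claimed):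
  **`Step6a_coefficientBound`** («(4.9) into (4.5) yields (4.10) T^m ≤ N∫(C′/(1+‖x‖)^k)²» — the
  Leibniz sum `Σ_p C(m,p) = 2ᵐ` is dropped) and **`Step6b_seriesBounded`** («T^m ≤ C for all m ⇒ the
  kinetic energy Σ_m T^m (t−t⁰)^m/m! is bounded for all t ≥ 0» — with `T^m ≡ 1` the sum is `eᵗ`).

## COMPOSITION — proved as `claim_of_steps`

`claim_of_steps : Step1 → Step2 → Step3 → Step4 → Step5 → Step6 → ClaimedTheorem` — PROVED: for a Clay
datum, Step 2 makes it analytic, Step 3 produces an analytic global `(u, p)` (hence smooth on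
`ℝ³ × [0,∞)` and a solution of (1)–(3), bridge `isNavierStokesSolution_and_smooth_iff`), Steps 4–5 feed
Step 6, which returns (7). The paper's logic COMPOSES; the adjudication is about Step 2 (first) and,
under the charitable restriction to analytic data (which the paper itself adopts for (B)), Step 3 (its
printed inference = `Step3_inference_heat`), then Steps 4–6.

## Design / conventions

* `E3 = EuclideanSpace ℝ (Fin 3)`; «real analytic on an open set» (Def. 2.1) = Mathlib `AnalyticOnNhd ℝ`;
  space-time functions are `uncurry u : ℝ × E3 → _`; «analytic on ℝ³ × [0,∞)» = analytic on the open
  set `(−ε, ∞) × ℝ³` for some `ε > 0` (`IsAnalyticGlobalSolution`), where the pair is also a classical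
  solution (tree `IsClassicalNSSolutionOn (Ioi (−ε)) ν 0 u p`) with `u 0 = u⁰`.
* `∂ₜᵐ u(0, x)` = `iteratedDeriv m (fun t => u t x) 0`; energies are Bochner integrals; the series of
  Step 4 is a `HasSum` (no `tsum` junk); (7) = the tree's `HasBoundedEnergy`.
* No instance, no notation, no axiom, no sorry; (A), (B) are cited through `ClayVariants`, not restated.

WHAT THIS IS NOT: not a claim about NS regularity or blow-up; not a claim about any author beyond the
typed locator.
-/

noncomputable section

open Set Function Filter MeasureTheory
open scoped Topology ENNReal ContDiff RealInnerProductSpace Nat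

namespace Literature.Claims.NS.Strange2025

open Literature.Analysis.FluidPDE

/-! ## §A. Vocabulary (definitions with bodies; nothing asserted) -/

/-- Physical space `ℝ³` (`N = 3`, the case of Cor. 4.1). [cite: Strange2025, §1.1 (A)] -/
abbrev E3 : Type := EuclideanSpace ℝ (Fin 3)

/-- «`u, p ∈ C^ω(X)` on all of space-time» as Cor. 4.1 uses Theorem 3.2 («u_j(t,x), p(t,x) ∈ C^ω(ℝ^N)
⊂ C^∞(ℝ^N)», p. 12, on «ℝ³ × [0,∞)»; Def. 2.1 p. 4: locally convergent power series at each point of an OPEN set):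
the pair `(u, p)` is real-analytic on the open space-time set `(−ε, ∞) × ℝ³` for some `ε > 0`, is a
classical solution of (1)–(2) there with `f ≡ 0`, and `u(0,·) = u⁰` ((3), `t⁰ = 0`).
[cite: Strange2025, Theorem 3.2 p. 8; Corollary 4.1 proof p. 12] -/
def IsAnalyticGlobalSolution (ν : ℝ) (u₀ : E3 → E3) (u : ℝ → E3 → E3) (p : ℝ → E3 → ℝ) : Prop :=
  ∃ ε : ℝ, 0 < ε ∧ AnalyticOnNhd ℝ (uncurry u) (Ioi (-ε) ×ˢ univ) ∧
    AnalyticOnNhd ℝ (uncurry p) (Ioi (-ε) ×ˢ univ) ∧ IsClassicalNSSolutionOn (Ioi (-ε)) ν 0 u p ∧ u 0 = u₀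

/-- The `m`-th time derivative of the velocity at `t⁰ = 0`, `u^m_j(t⁰, x) = (∂/∂t)^m u_j(t,x)|_{t=t⁰}`
((4.4) [`alt_taylor`] p. 12, (2.10) p. 3). [cite: Strange2025, (4.4) p. 12; (2.10) p. 3] -/
def timeDeriv (u : ℝ → E3 → E3) (m : ℕ) (x : E3) : E3 :=
  iteratedDeriv m (fun t => u t x) 0

/-- The Taylor coefficient `T^m(t⁰)` of the kinetic energy `∫_{ℝ³}‖u(t,x)‖² dx` at `t⁰ = 0` in the
Leibniz form of (3.21)/(3.22) p. 10–11 (without the `½` of (3.22), matching (4.5) p. 12):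
`T^m = ∫ Σ_{p=0}^{m} C(m,p) ⟪∂ₜᵖu(0,x), ∂ₜ^{m−p}u(0,x)⟫ dx` (= the `m`-th time derivative of the
energy at `0` for a solution regular enough). Bochner integral.
[cite: Strange2025, (3.22) p. 11; (4.5) p. 12] -/
def energyCoeff (u : ℝ → E3 → E3) (m : ℕ) : ℝ :=
  ∫ x, ∑ p ∈ Finset.range (m + 1), (m.choose p : ℝ) * ⟪timeDeriv u p x, timeDeriv u (m - p) x⟫

/-! ## §B. The claimed statements -/

/-- **Corollary 4.1** (§4, p. 11) = Fefferman's statement (A), restated verbatim in the paper (with the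
misprint «p(t,x) and f(t,x)» for `p` and `u`): typed AS Clay (A) through the Literature-side mirror
`ClayVariants.clayR3.Regularity` (token-for-token the summit body; never restated in claim files).
[cite: Strange2025, Corollary 4.1 p. 11; §1.1 (A) p. 1–2] -/
def ClaimedTheorem : Prop :=
  ClayVariants.clayR3.Regularity

/-- **Corollary 4.2** (§4, p. 13) = Fefferman's (B) RESTRICTED to real-analytic periodic data («for u⁰_j(x),
p⁰_j(x+e_j) ∈ C^ω(X)»; §1.1: «(B) is true if the initial conditions for velocity and pressure are
analytic» — the pressure «initial condition» is the paper's addition and is not part of (B); dropped):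
for every `ν > 0` and every smooth, divergence-free, lattice-periodic AND real-analytic datum the
periodic Clay problem is solvable (`ClayVariants.clayPeriodic.Solvable`). Δ4 (data class) w.r.t. (B).
[cite: Strange2025, Corollary 4.2 p. 13; §1.1 (B) p. 2] -/
def ClaimedTheoremB : Prop :=
  ∀ ν : ℝ, 0 < ν → ∀ u₀ : E3 → E3, ContDiff ℝ ∞ u₀ → NSWave0.IsDivFree u₀ → IsLatticePeriodic u₀ →
    AnalyticOnNhd ℝ u₀ univ → ClayVariants.clayPeriodic.Solvable ν 0 u₀

/-- `ClaimedTheorem` is Clay (A) (definitional). [cite: Strange2025, Corollary 4.1 p. 11] -/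
theorem clay_of_claimed (h : ClaimedTheorem) : ClayVariants.clayR3.Regularity := h

/-- … and conversely (the claim is (A) itself, no delta). [cite: Strange2025, Corollary 4.1 p. 11] -/
theorem claimedTheorem_iff : ClaimedTheorem ↔ ClayVariants.clayR3.Regularity := Iff.rfl

/-! ## §C. The steps (the printed proof of Corollary 4.1, in dependency order) -/

/-- **Step 1** — Proposition 2.2, (2.17), p. 4 (§2.4, after Krantz–Parks, *A primer of real analytic functions*):
«Let f ∈ C^∞(U) … f is in fact in C^ω(U) if and only if, for each x ∈ U, there is an open ball V, with
x ∈ V ⊆ U, and constants C > 0 and R > 0 such that the derivatives of f satisfy (2.17)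
|f^α(x⁰)| ≤ C·α!/R^{|α|}, ∀ x⁰ ∈ V.» Typed for scalar functions on open subsets of `ℝ³` with the
Fréchet derivative norm and `n!` (equivalent up to constants). Classical.
[cite: Strange2025, Proposition 2.2 (2.17) p. 4] -/
def Step1_Prop22 : Prop :=
  ∀ (U : Set E3) (f : E3 → ℝ), IsOpen U → ContDiffOn ℝ ∞ f U →
    (AnalyticOnNhd ℝ f U ↔
      ∀ x ∈ U, ∃ r C R : ℝ, 0 < r ∧ 0 < C ∧ 0 < R ∧ Metric.ball x r ⊆ U ∧
        ∀ x₀ ∈ Metric.ball x r, ∀ n : ℕ, ‖iteratedFDeriv ℝ n f x₀‖ ≤ C * (n ! : ℝ) / R ^ n)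

/-- **Step 2 — FIRST LOAD-BEARING STEP** — Corollary 4.1 proof, display (4.3) [`velcond1b`] and the
sentence after it (p. 12): «The initial velocity condition in (4.1) is consistent with Proposition 2.2: (4.3)
|∂^α u⁰_j(x⁰)| ≤ C_{αk}/(1+‖x⁰‖)^k ≤ U/R^{|α|} α!. Therefore the initial condition u_j(t⁰,x) = u⁰_j(x)
is analytic for any x ∈ ℝ^N.» Typed: every smooth divergence-free field with Fefferman's decay (4) is
real-analytic on `ℝ³`. [cite: Strange2025, Corollary 4.1 proof (4.3) p. 12] -/
def Step2_ClayDataAnalytic : Prop :=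
  ∀ u₀ : E3 → E3, ContDiff ℝ ∞ u₀ → NSWave0.IsDivFree u₀ → HasRapidSpatialDecay u₀ →
    AnalyticOnNhd ℝ u₀ univ

/-- **Step 3** — Theorem 3.2 (p. 8, §3.3) in the form Corollary 4.1 consumes (p. 12: «As force is identically zero,
by Theorem 3.2, u_j(t,x), p(t,x) ∈ C^ω(ℝ^N) ⊂ C^∞(ℝ^N)»; Thm 3.2: «if the forces f_j ∈ C^ω(X) and initial
velocities u_j(t⁰,x) ∈ C^ω(X) for t, t⁰, x ∈ X ⊆ ℝ^{N+1}, then u(t,x) ∈ C^ω(X) and p(t,x) ∈ C^ω(X)»,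
p. 9: «(3.8) is enough to find u_j(t,x)»): for `ν > 0`, `N = 3`, `f ≡ 0` and every real-analytic
divergence-free datum there is a pair `(u, p)` real-analytic on an open space-time set containing
`[0,∞) × ℝ³` solving (1)–(3). (Printed for all `N`, analytic `f`, general `X`; the recurrence
(3.8) [`momentum_sol`] = (1.1) differentiated is automatic for smooth solutions and not typed.)
[cite: Strange2025, Theorem 3.2 (3.8) p. 8; Corollary 4.1 proof p. 12] -/
def Step3_Theorem32 : Prop :=
  ∀ ν : ℝ, 0 < ν → ∀ u₀ : E3 → E3, AnalyticOnNhd ℝ u₀ univ → NSWave0.IsDivFree u₀ →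
    ∃ (u : ℝ → E3 → E3) (p : ℝ → E3 → ℝ), IsAnalyticGlobalSolution ν u₀ u p

/-- **Step 3, F15 twin (the printed inference at the grain it is stated in)** — proof of Theorem 3.2
(p. 8): «By Propositions 2.3 and 2.4, if u_j(t⁰,x), f_j(t,x), p(t⁰,x) ∈ C^ω(X) … then the right hand
side of (1.1) is analytic and u(t,x) ∈ C^ω(X)»; §1 p. 1: «The Cauchy–Kovalevskaya Theorem
tells us that a system of analytic differential equations with analytic initial conditions will have an
analytic solution. … the Navier-Stokes equations meet these conditions.» Instanced on the scalar model
the inference covers verbatim — the heat equation `∂ₜh = ν ∂ₓ²h` on `ℝ` (one momentum equation with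
`u = (h(t,x₂),0,0)`, no pressure gradient, no convection): every real-analytic datum admits a solution
JOINTLY real-analytic on an open space-time set containing `{0} × ℝ`. (Kovalevskaya's phenomenon:
false for `h₀ = 1/(1+x²)`; barrier `TimeTaylorFiniteRadius`.) No implication to or from
`Step3_Theorem32` is asserted (REF decides the charge).
[cite: Strange2025, Theorem 3.2 proof p. 8; §1 p. 1 (Cauchy–Kovalevskaya sentence)] -/
def Step3_inference_heat : Prop :=
  ∀ ν : ℝ, 0 < ν → ∀ h₀ : ℝ → ℝ, AnalyticOnNhd ℝ h₀ univ →
    ∃ ε : ℝ, 0 < ε ∧ ∃ h : ℝ → ℝ → ℝ, AnalyticOnNhd ℝ (uncurry h) (Ioi (-ε) ×ˢ univ) ∧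
      (∀ t ∈ Ioi (-ε), ∀ x : ℝ, deriv (fun s => h s x) t = ν * iteratedDeriv 2 (h t) x) ∧ h 0 = h₀

/-- **Step 4** — Corollary 4.1 proof, (4.4)–(4.5) [`alt_taylor`, `ke_constaint`] (p. 12): «expand u(t,x) as a
univariate Taylor series in t alone: (4.4) u_j(t,x) = Σ_m u_j^m(t⁰,x) Δ_m(t;t⁰) … The integral in
(4.2) can be written with this series as (4.5) ∫_{ℝ³}‖u(t,x)‖² dx = Σ_m (∫_{ℝ³}‖u^m(t⁰,x)‖² dx)
Δ_m(t;t⁰) = T^m(t⁰) Δ_m», used for ALL `t ≥ 0`: for every analytic global solution from a Clay datum,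
the kinetic energy at every `t ≥ 0` is the SUM of its time-Taylor series at `t⁰ = 0` with the Leibniz
coefficients `energyCoeff` of (3.22). [cite: Strange2025, Corollary 4.1 proof (4.4)–(4.5) p. 12] -/
def Step4_TimeSeriesEnergy : Prop :=
  ∀ ν : ℝ, 0 < ν → ∀ (u₀ : E3 → E3) (u : ℝ → E3 → E3) (p : ℝ → E3 → ℝ),
    ContDiff ℝ ∞ u₀ → NSWave0.IsDivFree u₀ → HasRapidSpatialDecay u₀ →
    IsAnalyticGlobalSolution ν u₀ u p →
      ∀ t : ℝ, 0 ≤ t → HasSum (fun m : ℕ => energyCoeff u m * t ^ m / (m ! : ℝ)) (∫ x, ‖u t x‖ ^ 2)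

/-- **Step 5** — Corollary 4.1 proof, (4.6)–(4.9) [`goal`, `goal_met`] (p. 12): «Next, let C_k = limsup_{α→∞} C_{kα}
and assume the bounds on the u^{0α} derivatives also hold for the u^{mα} derivatives: (4.6)
|u_j^m(t⁰,x)| ≤ C_k/(1+‖x‖)^k … This is consistent with the assumption in (4.6): (4.9)
|u_j^m(t⁰,x)| ≤ νN C_k/(1+‖x‖)^k + 2N(C_k/(1+‖x‖)^k)^m ≤ C′_{αk}/(1+‖x‖)^k»: for every analytic global
solution from a Clay datum and every `k`, ONE constant bounds `(1+‖x‖)^k ‖∂ₜᵐu(0,x)‖` for ALL `m`.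
[cite: Strange2025, Corollary 4.1 proof (4.6)–(4.9) p. 12] -/
def Step5_DerivativeDecay : Prop :=
  ∀ ν : ℝ, 0 < ν → ∀ (u₀ : E3 → E3) (u : ℝ → E3 → E3) (p : ℝ → E3 → ℝ),
    ContDiff ℝ ∞ u₀ → NSWave0.IsDivFree u₀ → HasRapidSpatialDecay u₀ →
    IsAnalyticGlobalSolution ν u₀ u p →
      ∀ k : ℕ, ∃ C : ℝ, ∀ m : ℕ, ∀ x : E3, ‖timeDeriv u m x‖ ≤ C / (1 + ‖x‖) ^ k

/-- **Step 6** — Corollary 4.1 proof, (4.10) [`kebound`] p. 12 to «□» p. 13: «Putting this constraint into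
(4.5) yields (4.10) T^m(t⁰) ≤ N∫_{ℝ³}(C′_k/(1+‖x‖)^k)² dx … Therefore, T^m(t⁰) ≤ C where
C ≥ 0 for all m if k ≥ 1, and the flow's kinetic energy in (4.5) is bounded.» NS-level form
consumed by the composition: the time-series representation of the energy (Step 4's conclusion) and the
`m`-uniform decay of the time derivatives (Step 5's conclusion) imply Fefferman's (7). Its two printed
inferences are typed below at scalar grain (`Step6a_coefficientBound`, `Step6b_seriesBounded`).
[cite: Strange2025, Corollary 4.1 proof (4.10) p. 12–13] -/
def Step6_EnergyBounded : Prop :=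
  ∀ ν : ℝ, 0 < ν → ∀ (u₀ : E3 → E3) (u : ℝ → E3 → E3) (p : ℝ → E3 → ℝ),
    IsAnalyticGlobalSolution ν u₀ u p →
    (∀ t : ℝ, 0 ≤ t → HasSum (fun m : ℕ => energyCoeff u m * t ^ m / (m ! : ℝ)) (∫ x, ‖u t x‖ ^ 2)) →
    (∀ k : ℕ, ∃ C : ℝ, ∀ m : ℕ, ∀ x : E3, ‖timeDeriv u m x‖ ≤ C / (1 + ‖x‖) ^ k) →
      HasBoundedEnergy u

/-- **Step 6a, F15 twin** — (4.10) p. 12: «Putting this constraint [(4.9): |u_j^m(t⁰,x)| ≤ C′/(1+‖x‖)^k for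
all m] into (4.5) yields T^m(t⁰) ≤ N ∫_{ℝ³}(C′/(1+‖x‖)^k)² dx» — at the grain of the display:
for ANY family of fields `v m` (the `∂ₜᵐu(t⁰,·)`) obeying the pointwise bound, the Leibniz coefficients
`∫ Σ_p C(m,p)⟪v p, v (m−p)⟫` are bounded by `N∫(C′/(1+‖x‖)^k)²`, uniformly in `m` (`N = 3`; `k = 2` so
that the right side is finite — the print's «k ≥ 1» is the one-dimensional count).
[cite: Strange2025, Corollary 4.1 proof (4.10) p. 12] -/
def Step6a_coefficientBound : Prop :=
  ∀ (v : ℕ → E3 → E3) (C' : ℝ), 0 ≤ C' →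
    (∀ m x, ‖v m x‖ ≤ C' / (1 + ‖x‖) ^ 2) → (∀ m, Continuous (v m)) →
    ∀ m : ℕ, ∫ x, ∑ p ∈ Finset.range (m + 1), (m.choose p : ℝ) * ⟪v p x, v (m - p) x⟫ ≤
      3 * ∫ x : E3, (C' / (1 + ‖x‖) ^ 2) ^ 2

/-- **Step 6b, F15 twin** — last sentence of the proof of Cor. 4.1 (p. 13): «Therefore, T^m(t⁰) ≤ C where
C ≥ 0 for all m …, and the flow's kinetic energy in (4.5) [= Σ_m T^m(t⁰) Δ_m(t;t⁰),
Δ_m = (t−t⁰)^m/m!, (2.13)] is bounded [for all t ≥ 0, (4.2)]»: a power series in `t` whose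
coefficients `T^m` are bounded by `C` has sums bounded uniformly in `t ≥ 0`.
[cite: Strange2025, Corollary 4.1 proof, last sentence p. 13] -/
def Step6b_seriesBounded : Prop :=
  ∀ (T : ℕ → ℝ) (C : ℝ), (∀ m, |T m| ≤ C) →
    ∃ C₁ : ℝ, ∀ t : ℝ, 0 ≤ t → ∀ S : ℝ, HasSum (fun m : ℕ => T m * t ^ m / (m ! : ℝ)) S → S ≤ C₁

/-! ## §D. Composition (kernel) -/

/-- An analytic global solution is smooth on `ℝ³ × [0,∞)` and a solution of (1)–(3) there (restriction
from the open time set `(−ε, ∞)` to `[0,∞)`; bridge `isNavierStokesSolution_and_smooth_iff`).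
[cite: Strange2025, Corollary 4.1 proof p. 12: «C^ω(ℝ^N) ⊂ C^∞(ℝ^N)»] -/
theorem clayFields_of_isAnalyticGlobalSolution {ν : ℝ} {u₀ : E3 → E3} {u : ℝ → E3 → E3}
    {p : ℝ → E3 → ℝ} (h : IsAnalyticGlobalSolution ν u₀ u p) :
    IsSmoothOnHalfSpace u ∧ IsSmoothOnHalfSpace p ∧ IsNavierStokesSolution ν 0 u₀ u p := by
  obtain ⟨ε, hε, -, -, hcl, h0⟩ := h
  have hsub : Ici (0 : ℝ) ⊆ Ioi (-ε) := fun t ht => by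
    simp only [mem_Ici] at ht
    simp only [mem_Ioi]
    linarith
  have hcl0 : IsClassicalNSSolutionOn (Ici 0) ν 0 u p := hcl.mono hsub (uniqueDiffOn_Ici 0)
  obtain ⟨hns, hsu, hsp⟩ :=
    (isNavierStokesSolution_and_smooth_iff (ν := ν) (f := 0) (u₀ := u₀) (u := u) (p := p)).2
      ⟨hcl0, h0⟩
  exact ⟨hsu, hsp, hns⟩

/-- **COMPOSITION** — the printed proof of Corollary 4.1: `Step 1 → … → Step 6 → (A)` — PROVED.
Clay datum ⇒ analytic (Step 2) ⇒ analytic global `(u, p)` (Step 3) ⇒ smooth on `ℝ³ × [0,∞)` solving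
(1)–(3); energy (7) from Steps 4, 5 via Step 6. Step 1 is support (underscored).
[cite: Strange2025, Corollary 4.1 p. 11 and its proof p. 12–13] -/
theorem claim_of_steps (_h1 : Step1_Prop22) (h2 : Step2_ClayDataAnalytic) (h3 : Step3_Theorem32)
    (h4 : Step4_TimeSeriesEnergy) (h5 : Step5_DerivativeDecay) (h6 : Step6_EnergyBounded) :
    ClaimedTheorem := by
  intro ν hν u₀ hu₀ hdiv hdec
  have han : AnalyticOnNhd ℝ u₀ univ := h2 u₀ hu₀ hdiv hdec
  obtain ⟨u, p, hsol⟩ := h3 ν hν u₀ han hdiv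
  obtain ⟨hsu, hsp, hns⟩ := clayFields_of_isAnalyticGlobalSolution hsol
  refine ⟨u, p, hsu, hsp, hns, ?_⟩
  exact h6 ν hν u₀ u p hsol (h4 ν hν u₀ u p hu₀ hdiv hdec hsol) (h5 ν hν u₀ u p hu₀ hdiv hdec hsol)

/-! ## In-file discharge of Step 1 (D-0026; statement unchanged)

Proposition 2.2 (2.17) is Krantz–Parks' characterisation of real-analytic functions of several
variables by locally uniform factorial bounds on the derivatives (Prop. 2.2.10); BOTH directions are
theorems of the tree's calculus library: necessity (Cauchy's estimates)
`AnalyticAt.exists_ball_norm_iteratedFDeriv_le` (`AnalyticCauchyEstimates.lean`) and sufficiency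
`Literature.Analysis.Calculus.analyticOnNhd_of_locally_norm_iteratedFDeriv_le`
(`AnalyticOfFDerivBound.lean`). The discharge below is constant bookkeeping between the two shapes
`M·Cᵏ·k!` and `C′·k!/Rᵏ` (`C′ = M + 1`, `R = (C + 1)⁻¹`, resp. `M = C′`, `C = R⁻¹`). -/

/-- **Step 1 HOLDS — kernel** (Proposition 2.2 (2.17) p. 4, after Krantz–Parks Prop. 2.2.10): a `C^∞`
function on an open `U ⊆ ℝ³` is real-analytic on `U` iff every point of `U` has a ball in `U` on which
`‖Dⁿf(x⁰)‖ ≤ C·n!/Rⁿ` for all `n`. Both directions from the tree (`AnalyticAt.exists_ball_norm_iteratedFDeriv_le`,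
`analyticOnNhd_of_locally_norm_iteratedFDeriv_le`). Upstream of the row's locator (#58 @ `Step2_ClayDataAnalytic`),
not load-bearing. [cite: Strange2025, Proposition 2.2 (2.17) p. 4] [cite: KrantzParks2002, Prop. 2.2.10] -/
theorem step1_Prop22_holds : Step1_Prop22 := by
  intro U f hU hf
  constructor
  · -- necessity: Cauchy's estimates, locally uniform
    intro hA x hx
    obtain ⟨δ, hδ, M, C, hM, hC, hb⟩ := (hA x hx).exists_ball_norm_iteratedFDeriv_le
    obtain ⟨ε, hε, hεU⟩ := Metric.isOpen_iff.1 hU x hx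
    refine ⟨min δ ε, M + 1, (C + 1)⁻¹, lt_min hδ hε, by linarith, by positivity,
      (Metric.ball_subset_ball (min_le_right δ ε)).trans hεU, fun x₀ hx₀ n => ?_⟩
    have hx₀δ : x₀ ∈ Metric.ball x δ := Metric.ball_subset_ball (min_le_left δ ε) hx₀
    have hCn : C ^ n ≤ (C + 1) ^ n := pow_le_pow_left₀ hC (by linarith) n
    calc ‖iteratedFDeriv ℝ n f x₀‖ ≤ M * C ^ n * n ! := hb x₀ hx₀δ n
      _ ≤ (M + 1) * (C + 1) ^ n * n ! := by
          gcongr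
          · linarith
      _ = (M + 1) * (n ! : ℝ) / (C + 1)⁻¹ ^ n := by
          rw [inv_pow, div_inv_eq_mul]; ring
  · -- sufficiency: factorial bounds ⇒ analytic (Krantz–Parks Prop. 2.2.10)
    intro hb
    refine Literature.Analysis.Calculus.analyticOnNhd_of_locally_norm_iteratedFDeriv_le hU hf
      fun x hx => ?_
    obtain ⟨r, C, R, hr, hC, hR, hrU, hb'⟩ := hb x hx
    refine ⟨r, hr, C, R⁻¹, hrU, fun k z hz => ?_⟩
    calc ‖iteratedFDeriv ℝ k f z‖ ≤ C * (k ! : ℝ) / R ^ k := hb' z hz k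
      _ = C * R⁻¹ ^ k * k ! := by rw [inv_pow, div_eq_mul_inv]; ring

end Literature.Claims.NS.Strange2025

end
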